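import Summits.NavierStokesRegularity.FunctionalMining.LatticeTrilinearRegion
import Literature.Analysis.FluidPDE.FracNSGalerkinExistence
import Literature.Analysis.FunctionSpaces.ContDiffHolderLogConvex
import HarnessLib

/-!
# FunctionalMining — the lattice trilinear estimate on `ℤ³` (all frequency regions)

Search for candidate a priori estimates; no regularity claim. Cell `pub-nsfunc`, prove seat
(gen 12). Third file of the lattice side of the rows `EF.s | T_LD | G1`. For nonnegative families
`a, b, c : ℤ³ → [0, ∞]` vanishing at the origin and the spectral weights
`σ_t(m) = (4π²|m|²)^t = fracSymbol t m`:

**Trilinear estimate** (`sq_tsum_tsum_conv_mul_le`): if `t₁, t₂, t₃ < 3/2` and `t₁ + t₂ + t₃ = 3/2`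
there is `K ≥ 0` with

`(∑_k ∑_j a(k - j) b(j) c(k))² ≤ K (∑ σ_{t₁} a²) (∑ σ_{t₂} b²) (∑ σ_{t₃} c²)`.

This is the Fourier-majorant form of ALL the Sobolev product laws
`‖fg‖_{Ḣ^{s₁+s₂-3/2}} ≲ ‖f‖_{Ḣ^{s₁}} ‖g‖_{Ḣ^{s₂}}` on `T³` (`sᵢ < 3/2`, `s₁ + s₂ > 0`;
Bahouri–Chemin–Danchin 2011, Cor. 2.55; Constantin–Foias 1988, (6.10) for the trilinear form of
Navier–Stokes), read on absolute values of Fourier coefficients. Proof: with `p = k - j`, `q = j`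
the form is `∑_{p,q} a(p) b(q) c(p+q)`; every triple `(p, q, p + q)` of nonzero frequencies has a
smallest member, so the form is at most the sum of three region forms, each bounded by the region
lemma `sq_tsum_region_le` (`LatticeTrilinearRegion`) after the symmetries `p ↔ q` and
`(p, q) ↦ (-p, p + q)`; finally `(x + y + z)² ≤ 3(x² + y² + z²)` (tree).
-/

noncomputable section

open MeasureTheory Set Filter Topology Real
open scoped ENNReal NNReal

namespace Summit.NavierStokesRegularity.FunctionalMining

namespace LatticeTrilinear

open Literature.Analysis.FunctionSpaces.Torus Literature.Analysis.FluidPDE.Torus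
open Literature.Analysis.FluidPDE (fracSymbol_neg)

variable {d : Type*} [Fintype d]

/-! ## 1. Reflection invariance of the weighted sums

(`(x + y + z)² ≤ 3(x² + y² + z²)` in `ℝ≥0∞` is the tree's
`Literature.Analysis.FunctionSpaces.ENNReal.add_three_sq_le`.) -/

/-- The weighted square sums are reflection invariant: `∑ σ_t(m) a(-m)² = ∑ σ_t(m) a(m)²`. [folklore] -/
theorem tsum_fracSymbol_mul_sq_comp_neg (t : ℝ) (a : (d → ℤ) → ℝ≥0∞) :
    ∑' m : d → ℤ, ENNReal.ofReal (fracSymbol t m) * a (-m) ^ 2 =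
      ∑' m : d → ℤ, ENNReal.ofReal (fracSymbol t m) * a m ^ 2 := by
  rw [← (Equiv.neg (d → ℤ)).tsum_eq (fun m => ENNReal.ofReal (fracSymbol t m) * a m ^ 2)]
  refine tsum_congr fun m => ?_
  simp only [Equiv.neg_apply, fracSymbol_neg]

/-! ## 2. The change of variables `(k, j) ↦ (p, q) = (k - j, j)` -/

omit [Fintype d] in
/-- `∑_k ∑_j F(k - j, j, k) = ∑_p ∑_q F(p, q, p + q)` for `ℝ≥0∞`-valued `F`. [folklore] -/
theorem tsum_tsum_sub_eq (F : (d → ℤ) → (d → ℤ) → (d → ℤ) → ℝ≥0∞) :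
    ∑' k : d → ℤ, ∑' j : d → ℤ, F (k - j) j k = ∑' p : d → ℤ, ∑' q : d → ℤ, F p q (p + q) := by
  rw [ENNReal.tsum_comm]
  conv_rhs => rw [ENNReal.tsum_comm]
  refine tsum_congr fun j => ?_
  rw [← (Equiv.addRight j).tsum_eq (fun k => F (k - j) j k)]
  refine tsum_congr fun p => ?_
  simp only [Equiv.coe_addRight, add_sub_cancel_right]

/-! ## 3. Covering by the three regions -/

/-- **Every triple has a smallest frequency**: for `a, b, c` vanishing at the origin,
`a(p) b(q) c(p+q) ≤ 1_R(p, q) a b c + 1_R(q, p) b a c + 1_R(-p, p+q) ã c b` with `R` the region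
"second coordinate smallest" and `ã(m) = a(-m)`. [folklore] -/
theorem mul_mul_le_three_regions {a b c : (d → ℤ) → ℝ≥0∞} (ha : a 0 = 0) (hb : b 0 = 0) (hc : c 0 = 0)
    (p q : d → ℤ) :
    a p * b q * c (p + q) ≤
      {x : (d → ℤ) × (d → ℤ) | x.1 ≠ 0 ∧ x.2 ≠ 0 ∧ fracSymbol 1 x.2 ≤ fracSymbol 1 x.1 ∧
          fracSymbol 1 x.2 ≤ fracSymbol 1 (x.1 + x.2)}.indicator (fun x => a x.1 * b x.2 * c (x.1 + x.2)) (p, q) +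
      {x : (d → ℤ) × (d → ℤ) | x.1 ≠ 0 ∧ x.2 ≠ 0 ∧ fracSymbol 1 x.2 ≤ fracSymbol 1 x.1 ∧
          fracSymbol 1 x.2 ≤ fracSymbol 1 (x.1 + x.2)}.indicator (fun x => b x.1 * a x.2 * c (x.1 + x.2)) (q, p) +
      {x : (d → ℤ) × (d → ℤ) | x.1 ≠ 0 ∧ x.2 ≠ 0 ∧ fracSymbol 1 x.2 ≤ fracSymbol 1 x.1 ∧
          fracSymbol 1 x.2 ≤ fracSymbol 1 (x.1 + x.2)}.indicator
        (fun x => a (-x.1) * c x.2 * b (x.1 + x.2)) (-p, p + q) := by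
  set R : Set ((d → ℤ) × (d → ℤ)) := {x : (d → ℤ) × (d → ℤ) | x.1 ≠ 0 ∧ x.2 ≠ 0 ∧
    fracSymbol 1 x.2 ≤ fracSymbol 1 x.1 ∧ fracSymbol 1 x.2 ≤ fracSymbol 1 (x.1 + x.2)} with hR
  by_cases hp : p = 0
  · rw [hp, ha, zero_mul, zero_mul]; exact zero_le
  by_cases hq : q = 0
  · rw [hq, hb, mul_zero, zero_mul]; exact zero_le
  by_cases hr : p + q = 0
  · rw [hr, hc, mul_zero]; exact zero_le
  -- the smallest of `μ_p, μ_q, μ_{p+q}`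
  rcases le_total (fracSymbol 1 q) (fracSymbol 1 p) with hqp | hpq
  · rcases le_total (fracSymbol 1 q) (fracSymbol 1 (p + q)) with hqr | hrq
    · -- `q` smallest
      have hmem : (p, q) ∈ R := ⟨hp, hq, hqp, hqr⟩
      rw [indicator_of_mem hmem]
      exact le_add_right (le_add_right le_rfl)
    · -- `p + q` smallest
      have hmem : (-p, p + q) ∈ R := by
        refine ⟨neg_ne_zero.2 hp, hr, ?_, ?_⟩
        · show fracSymbol 1 (p + q) ≤ fracSymbol 1 (-p)
          rw [fracSymbol_neg]; exact hrq.trans hqp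
        · show fracSymbol 1 (p + q) ≤ fracSymbol 1 (-p + (p + q))
          rw [neg_add_cancel_left]; exact hrq
      rw [indicator_of_mem hmem]
      dsimp only
      rw [neg_neg, neg_add_cancel_left]
      calc a p * b q * c (p + q) = a p * c (p + q) * b q := by ring
        _ ≤ _ := le_add_left le_rfl
  · rcases le_total (fracSymbol 1 p) (fracSymbol 1 (p + q)) with hpr | hrp
    · -- `p` smallest
      have hmem : (q, p) ∈ R := by
        refine ⟨hq, hp, hpq, ?_⟩
        show fracSymbol 1 p ≤ fracSymbol 1 (q + p)
        rw [add_comm]; exact hpr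
      rw [indicator_of_mem hmem]
      dsimp only
      rw [add_comm q p]
      calc a p * b q * c (p + q) = b q * a p * c (p + q) := by ring
        _ ≤ _ := le_add_right (le_add_left le_rfl)
    · -- `p + q` smallest
      have hmem : (-p, p + q) ∈ R := by
        refine ⟨neg_ne_zero.2 hp, hr, ?_, ?_⟩
        · show fracSymbol 1 (p + q) ≤ fracSymbol 1 (-p)
          rw [fracSymbol_neg]; exact hrp
        · show fracSymbol 1 (p + q) ≤ fracSymbol 1 (-p + (p + q))
          rw [neg_add_cancel_left]; exact hrp.trans hpq
      rw [indicator_of_mem hmem]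
      dsimp only
      rw [neg_neg, neg_add_cancel_left]
      calc a p * b q * c (p + q) = a p * c (p + q) * b q := by ring
        _ ≤ _ := le_add_left le_rfl

/-! ## 4. The trilinear estimate -/

/-- **The lattice trilinear estimate on `ℤ³`.** Let `card d = 3`, `t₁, t₂, t₃ < 3/2` with
`t₁ + t₂ + t₃ = 3/2`. There is `K ≥ 0` such that for all `a b c : ℤ³ → [0, ∞]` vanishing at the
origin,
`(∑_k ∑_j a(k-j) b(j) c(k))² ≤ K (∑_m σ_{t₁}(m) a(m)²) (∑_m σ_{t₂}(m) b(m)²) (∑_m σ_{t₃}(m) c(m)²)`,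
`σ_t(m) = (4π²|m|²)^t`. Equivalently (duality) `‖fg‖_{Ḣ^{-t₃}} ≲ ‖f‖_{Ḣ^{t₁}}‖g‖_{Ḣ^{t₂}}` for
mean-free `f, g` on `T³`, read on Fourier majorants: the full range of the Sobolev product laws in
dimension three. [folklore; Bahouri–Chemin–Danchin 2011 Cor. 2.55, Constantin–Foias 1988 (6.10)] -/
theorem sq_tsum_tsum_conv_mul_le (hd : Fintype.card d = 3) {t₁ t₂ t₃ : ℝ} (ht₁ : t₁ < 3 / 2)
    (ht₂ : t₂ < 3 / 2) (ht₃ : t₃ < 3 / 2) (hsum : t₁ + t₂ + t₃ = 3 / 2) :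
    ∃ K : ℝ, 0 ≤ K ∧ ∀ a b c : (d → ℤ) → ℝ≥0∞, a 0 = 0 → b 0 = 0 → c 0 = 0 →
      (∑' k : d → ℤ, ∑' j : d → ℤ, a (k - j) * b j * c k) ^ 2 ≤
        ENNReal.ofReal K * (∑' m, ENNReal.ofReal (fracSymbol t₁ m) * a m ^ 2) *
          (∑' m, ENNReal.ofReal (fracSymbol t₂ m) * b m ^ 2) *
          (∑' m, ENNReal.ofReal (fracSymbol t₃ m) * c m ^ 2) := by
  obtain ⟨K₂, hK₂, h₂⟩ := sq_tsum_region_le (d := d) hd (t₁ := t₁) (t₂ := t₂) (t₃ := t₃) ht₂ hsum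
  obtain ⟨K₁, hK₁, h₁⟩ := sq_tsum_region_le (d := d) hd (t₁ := t₂) (t₂ := t₁) (t₃ := t₃) ht₁ (by linarith)
  obtain ⟨K₃, hK₃, h₃⟩ := sq_tsum_region_le (d := d) hd (t₁ := t₁) (t₂ := t₃) (t₃ := t₂) ht₃ (by linarith)
  set R : Set ((d → ℤ) × (d → ℤ)) := {x : (d → ℤ) × (d → ℤ) | x.1 ≠ 0 ∧ x.2 ≠ 0 ∧
    fracSymbol 1 x.2 ≤ fracSymbol 1 x.1 ∧ fracSymbol 1 x.2 ≤ fracSymbol 1 (x.1 + x.2)} with hR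
  refine ⟨3 * (K₂ + K₁ + K₃), by positivity, fun a b c ha hb hc => ?_⟩
  set N₁ := ∑' m, ENNReal.ofReal (fracSymbol t₁ m) * a m ^ 2 with hN₁
  set N₂ := ∑' m, ENNReal.ofReal (fracSymbol t₂ m) * b m ^ 2 with hN₂
  set N₃ := ∑' m, ENNReal.ofReal (fracSymbol t₃ m) * c m ^ 2 with hN₃
  -- the three region forms
  set S₂ := ∑' p : d → ℤ, ∑' q : d → ℤ, R.indicator (fun x => a x.1 * b x.2 * c (x.1 + x.2)) (p, q) with hS₂
  set S₁ := ∑' p : d → ℤ, ∑' q : d → ℤ, R.indicator (fun x => b x.1 * a x.2 * c (x.1 + x.2)) (p, q) with hS₁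
  set S₃ := ∑' p : d → ℤ, ∑' q : d → ℤ, R.indicator (fun x => a (-x.1) * c x.2 * b (x.1 + x.2)) (p, q)
    with hS₃
  have hS₂le : S₂ ^ 2 ≤ ENNReal.ofReal K₂ * N₁ * N₂ * N₃ := h₂ a b c
  have hS₁le : S₁ ^ 2 ≤ ENNReal.ofReal K₁ * N₁ * N₂ * N₃ := by
    calc S₁ ^ 2 ≤ ENNReal.ofReal K₁ * N₂ * N₁ * N₃ := h₁ b a c
      _ = ENNReal.ofReal K₁ * N₁ * N₂ * N₃ := by ring
  have hS₃le : S₃ ^ 2 ≤ ENNReal.ofReal K₃ * N₁ * N₂ * N₃ := by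
    calc S₃ ^ 2 ≤ ENNReal.ofReal K₃ * (∑' m, ENNReal.ofReal (fracSymbol t₁ m) * a (-m) ^ 2) * N₃ * N₂ :=
          h₃ (fun m => a (-m)) c b
      _ = ENNReal.ofReal K₃ * N₁ * N₂ * N₃ := by rw [tsum_fracSymbol_mul_sq_comp_neg]; ring
  -- the form is dominated by the three region forms
  have hcover : ∑' k : d → ℤ, ∑' j : d → ℤ, a (k - j) * b j * c k ≤ S₂ + S₁ + S₃ := by
    rw [tsum_tsum_sub_eq (fun p q r => a p * b q * c r)]
    -- reindex the second and third region sums back to `(p, q)`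
    have e₁ : S₁ = ∑' p : d → ℤ, ∑' q : d → ℤ, R.indicator (fun x => b x.1 * a x.2 * c (x.1 + x.2)) (q, p) := by
      rw [hS₁, ENNReal.tsum_comm]
    have e₃ : S₃ = ∑' p : d → ℤ, ∑' q : d → ℤ,
        R.indicator (fun x => a (-x.1) * c x.2 * b (x.1 + x.2)) (-p, p + q) := by
      rw [hS₃, ← (Equiv.neg (d → ℤ)).tsum_eq]
      refine tsum_congr fun p => ?_
      rw [Equiv.neg_apply, ← (Equiv.addLeft p).tsum_eq]
      rfl
    rw [e₁, e₃, ← ENNReal.tsum_add, ← ENNReal.tsum_add]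
    refine ENNReal.tsum_le_tsum fun p => ?_
    rw [← ENNReal.tsum_add, ← ENNReal.tsum_add]
    refine ENNReal.tsum_le_tsum fun q => ?_
    exact mul_mul_le_three_regions ha hb hc p q
  calc (∑' k : d → ℤ, ∑' j : d → ℤ, a (k - j) * b j * c k) ^ 2
      ≤ (S₂ + S₁ + S₃) ^ 2 := pow_le_pow_left' hcover 2
    _ ≤ 3 * (S₂ ^ 2 + S₁ ^ 2 + S₃ ^ 2) := Literature.Analysis.FunctionSpaces.ENNReal.add_three_sq_le _ _ _
    _ ≤ 3 * (ENNReal.ofReal K₂ * N₁ * N₂ * N₃ + ENNReal.ofReal K₁ * N₁ * N₂ * N₃ +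
          ENNReal.ofReal K₃ * N₁ * N₂ * N₃) := by gcongr
    _ = ENNReal.ofReal (3 * (K₂ + K₁ + K₃)) * N₁ * N₂ * N₃ := by
        rw [ENNReal.ofReal_mul (by norm_num), ENNReal.ofReal_add (by positivity) hK₃,
          ENNReal.ofReal_add hK₂ hK₁, show ENNReal.ofReal 3 = 3 by norm_num]
        ring

end LatticeTrilinear

end Summit.NavierStokesRegularity.FunctionalMining
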